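import Mathlib.Algebra.MvPolynomial.Equiv
import Mathlib.Algebra.MvPolynomial.Rename
import Mathlib.RingTheory.MvPolynomial.WeightedHomogeneous
import Mathlib.RingTheory.Polynomial.Basic
import Mathlib.LinearAlgebra.Matrix.Determinant.Basic
import Mathlib.RingTheory.Ideal.Quotient.Operations
import Mathlib.Algebra.CharP.Defs
import HarnessLib

/-!
# CN data × 𝔸¹ — the bookkeeping lemmas: adding one variable (index `0`, old variables along `Fin.succ`) to a polynomial,
# its exponents, its chart matrices, its weighted initial forms and its Fedder certificates
# (crux `FInjectiveMacaulayfication` stmt-ResolutionOfSingularities-15315, chain w45a, hole #3; CRUX-PLAN v8 §5 «stub-5 → (iv) Q6-LINE»,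
# generic form announced 2026-08-27T05:2xZ)

Support file for crux stmt-ResolutionOfSingularities-15315 (`FrobeniusLadder.FInjectiveMacaulayfication`), chain w45a, seat
res-D-pv-017 AS res-L1-w45a-stub-5. [OURS · L1 W4.5a] — NOT a statement of any manuscript; AI-written, weaker than expert review.

Pure commutative algebra over `MvPolynomial`, no schemes: for `f ∈ k[X_{Fin n}]` and `f′ = rename Fin.succ f ∈ k[X_{Fin (n+1)}]`
(the new variable is `X 0`): (§1) exponent embedding `mapDomain Fin.succ`; (§2) a matrix `W` on `Fin (n+1)` in BLOCK FORM `1 ⊕ V`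
(hypotheses `W 0 0 = 1`, `W 0 (succ j) = 0`, `W (succ i) 0 = 0`, `W (succ i) (succ j) = V i j`): unimodularity, `mulVec`, column
monomials, row-subset weights; (§3) `rename Fin.succ` commutes with weighted homogeneous components for compatible weights; (§4)
primality of `(f′)`, `x̄ᵥ ≠ 0` in `k[X′]/(f′)`, `Xᵢ ∤ rename g`; (§5) Fedder non-membership `F^(p-1) ∉ ((Xᵢ − bᵢ)^p)` survives the extra
variable (specialise `X 0 ↦ b₀`). Consumed by `…CNCylinder.lean` (`strongPlusStep_cylinder_of_cnData`). No definitions, no named facts.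
[folklore]
-/

-- single-problem summit: the doubled namespace component is forced
set_option linter.dupNamespace false

noncomputable section

open MvPolynomial

namespace Summit.ResolutionOfSingularities.ResolutionOfSingularities.Theorems.FInjectiveMacaulayfication.CNCylinder

/-! ## §1 Exponents along `Fin.succ` -/

/-- `(x ∘ succ⁻¹) 0 = 0`. [folklore] -/
theorem mapDomain_succ_apply_zero {n : ℕ} (x : Fin n →₀ ℕ) : x.mapDomain Fin.succ 0 = 0 :=
  Finsupp.mapDomain_notin_range _ _ (by rintro ⟨i, hi⟩; exact Fin.succ_ne_zero i hi)

/-- `(x ∘ succ⁻¹) (succ i) = x i`. [folklore] -/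
theorem mapDomain_succ_apply_succ {n : ℕ} (x : Fin n →₀ ℕ) (i : Fin n) : x.mapDomain Fin.succ i.succ = x i :=
  Finsupp.mapDomain_apply (Fin.succ_injective n) x i

/-- A shifted exponent is non-zero at some shifted index iff the exponent is non-zero somewhere. [folklore] -/
theorem exists_succ_pos_of_ne_zero {n : ℕ} {x : Fin n →₀ ℕ} (hx : x ≠ 0) : ∃ i : Fin n, 0 < x.mapDomain Fin.succ i.succ := by
  obtain ⟨i, hi⟩ := Finsupp.ne_iff.mp hx
  exact ⟨i, by rw [mapDomain_succ_apply_succ]; exact Nat.pos_of_ne_zero hi⟩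

/-! ## §2 Block matrices `1 ⊕ V` -/

/-- `det (1 ⊕ V) = det V` over `ℤ`; in particular `1 ⊕ V` is unimodular if `V` is. [folklore] -/
theorem isUnit_det_block {n : ℕ} (V : Matrix (Fin n) (Fin n) ℕ) (W : Matrix (Fin (n + 1)) (Fin (n + 1)) ℕ)
    (hW00 : W 0 0 = 1) (hW0s : ∀ j : Fin n, W 0 j.succ = 0) (hWss : ∀ i j : Fin n, W i.succ j.succ = V i j)
    (hV : IsUnit (V.map (Nat.cast : ℕ → ℤ)).det) : IsUnit (W.map (Nat.cast : ℕ → ℤ)).det := by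
  have hsub : (W.map (Nat.cast : ℕ → ℤ)).submatrix Fin.succ Fin.succ = V.map (Nat.cast : ℕ → ℤ) := by
    ext i j
    simp [Matrix.submatrix_apply, hWss]
  rw [Matrix.det_succ_row_zero, Fin.sum_univ_succ]
  have htail : ∑ j : Fin n, (-1 : ℤ) ^ (j.succ : ℕ) * (W.map (Nat.cast : ℕ → ℤ)) 0 j.succ *
      ((W.map (Nat.cast : ℕ → ℤ)).submatrix Fin.succ j.succ.succAbove).det = 0 := by
    refine Finset.sum_eq_zero fun j _ => ?_
    simp [Matrix.map_apply, hW0s j]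
  rw [htail, add_zero, Fin.succAbove_zero, hsub]
  simpa [Matrix.map_apply, hW00] using hV

/-- `mulVec` in block form: `(1 ⊕ V)(s, x) = (s, V x)`, written for the exponents `x ∘ succ⁻¹ + s·e₀` used by the charts. [folklore] -/
theorem mulVec_block {n : ℕ} (V : Matrix (Fin n) (Fin n) ℕ) (W : Matrix (Fin (n + 1)) (Fin (n + 1)) ℕ)
    (hW00 : W 0 0 = 1) (hW0s : ∀ j : Fin n, W 0 j.succ = 0) (hWs0 : ∀ i : Fin n, W i.succ 0 = 0)
    (hWss : ∀ i j : Fin n, W i.succ j.succ = V i j) (x : Fin n →₀ ℕ) (s : ℕ) :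
    (Finsupp.equivFunOnFinite.symm (W.mulVec ⇑(x.mapDomain Fin.succ + Finsupp.single 0 s : Fin (n + 1) →₀ ℕ)) : Fin (n + 1) →₀ ℕ) =
      (Finsupp.equivFunOnFinite.symm (V.mulVec ⇑x) : Fin n →₀ ℕ).mapDomain Fin.succ + Finsupp.single 0 s := by
  ext i
  refine Fin.cases ?_ (fun i => ?_) i
  · simp [mapDomain_succ_apply_zero, Matrix.mulVec, dotProduct, Fin.sum_univ_succ, hW00, hW0s]
  · simp [mapDomain_succ_apply_succ, mapDomain_succ_apply_zero, Matrix.mulVec, dotProduct,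
      Fin.sum_univ_succ, hWs0, hWss, Finsupp.single_apply, (Fin.succ_ne_zero _).symm]

/-- The same with `s = 0`. [folklore] -/
theorem mulVec_block_zero {n : ℕ} (V : Matrix (Fin n) (Fin n) ℕ) (W : Matrix (Fin (n + 1)) (Fin (n + 1)) ℕ)
    (hW00 : W 0 0 = 1) (hW0s : ∀ j : Fin n, W 0 j.succ = 0) (hWs0 : ∀ i : Fin n, W i.succ 0 = 0)
    (hWss : ∀ i j : Fin n, W i.succ j.succ = V i j) (x : Fin n →₀ ℕ) :
    (Finsupp.equivFunOnFinite.symm (W.mulVec ⇑(x.mapDomain Fin.succ)) : Fin (n + 1) →₀ ℕ) =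
      (Finsupp.equivFunOnFinite.symm (V.mulVec ⇑x) : Fin n →₀ ℕ).mapDomain Fin.succ := by
  have h := mulVec_block V W hW00 hW0s hWs0 hWss x 0
  rwa [Finsupp.single_zero, add_zero, add_zero] at h

/-- The column monomials of `1 ⊕ V`: `θ′ 0 = X 0`. [folklore] -/
theorem colMonomial_block_zero {R : Type} [CommSemiring R] {n : ℕ} (W : Matrix (Fin (n + 1)) (Fin (n + 1)) ℕ)
    (hW00 : W 0 0 = 1) (hWs0 : ∀ i : Fin n, W i.succ 0 = 0) :
    (∏ i : Fin (n + 1), (X i : MvPolynomial (Fin (n + 1)) R) ^ W i 0) = X 0 := by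
  rw [Fin.prod_univ_succ, hW00, pow_one]
  have : ∏ i : Fin n, (X i.succ : MvPolynomial (Fin (n + 1)) R) ^ W i.succ 0 = 1 :=
    Finset.prod_eq_one fun i _ => by rw [hWs0, pow_zero]
  rw [this, mul_one]

/-- The column monomials of `1 ⊕ V`: `θ′ (succ j) = rename succ (θ j)`. [folklore] -/
theorem colMonomial_block_succ {R : Type} [CommSemiring R] {n : ℕ} (V : Matrix (Fin n) (Fin n) ℕ)
    (W : Matrix (Fin (n + 1)) (Fin (n + 1)) ℕ) (hW0s : ∀ j : Fin n, W 0 j.succ = 0)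
    (hWss : ∀ i j : Fin n, W i.succ j.succ = V i j) (j : Fin n) :
    (∏ i : Fin (n + 1), (X i : MvPolynomial (Fin (n + 1)) R) ^ W i j.succ) =
      rename Fin.succ (∏ i : Fin n, (X i : MvPolynomial (Fin n) R) ^ V i j) := by
  rw [Fin.prod_univ_succ, hW0s, pow_zero, one_mul, map_prod]
  refine Finset.prod_congr rfl fun i _ => ?_
  rw [map_pow, rename_X, hWss]

/-- Row-subset weights of `1 ⊕ V` on the old columns: `Σ_(i ∈ S) W i (succ j) = Σ_(i' : succ i' ∈ S) V i' j`. [folklore] -/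
theorem weight_block_succ {n : ℕ} (V : Matrix (Fin n) (Fin n) ℕ) (W : Matrix (Fin (n + 1)) (Fin (n + 1)) ℕ)
    (hW0s : ∀ j : Fin n, W 0 j.succ = 0) (hWss : ∀ i j : Fin n, W i.succ j.succ = V i j)
    (S : Finset (Fin (n + 1))) (j : Fin n) :
    ∑ i ∈ S, W i j.succ = ∑ i ∈ Finset.univ.filter (fun i : Fin n => i.succ ∈ S), V i j := by
  classical
  have h1 : ∑ i ∈ S, W i j.succ = ∑ i : Fin (n + 1), if i ∈ S then W i j.succ else 0 := by
    rw [Finset.sum_ite_mem, Finset.univ_inter]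
  rw [h1, Fin.sum_univ_succ, Finset.sum_filter]
  have h2 : (if (0 : Fin (n + 1)) ∈ S then W 0 j.succ else 0) = 0 := by
    rw [hW0s]
    exact ite_self 0
  rw [h2, zero_add]
  refine Finset.sum_congr rfl fun i _ => ?_
  rw [hWss]

/-! ## §3 Weighted homogeneous components along `rename Fin.succ` -/

/-- The weight of a shifted exponent for weights `w′` is the weight of the exponent for `w′ ∘ succ`. [folklore] -/
theorem weight_mapDomain_succ {n : ℕ} (w' : Fin (n + 1) → ℕ) (d : Fin n →₀ ℕ) :
    Finsupp.weight w' (d.mapDomain Fin.succ) = Finsupp.weight (w' ∘ Fin.succ) d := by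
  simp only [Finsupp.weight_apply]
  rw [Finsupp.sum_mapDomain_index_inj (Fin.succ_injective n)]
  rfl

/-- **`rename Fin.succ` commutes with weighted homogeneous components** for compatible weights `w = w′ ∘ succ` (coefficientwise:
shifted exponents keep their weight and their coefficient; unshifted exponents have coefficient `0` in a renamed polynomial). [folklore] -/
theorem weightedHomogeneousComponent_rename_succ {R : Type} [CommSemiring R] {n : ℕ} (w' : Fin (n + 1) → ℕ) (D : ℕ)
    (f : MvPolynomial (Fin n) R) :
    weightedHomogeneousComponent w' D (rename Fin.succ f) = rename Fin.succ (weightedHomogeneousComponent (w' ∘ Fin.succ) D f) := by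
  classical
  ext d
  by_cases hd : ∃ u : Fin n →₀ ℕ, u.mapDomain Fin.succ = d
  · obtain ⟨u, rfl⟩ := hd
    rw [coeff_weightedHomogeneousComponent, coeff_rename_mapDomain _ (Fin.succ_injective n),
      coeff_rename_mapDomain _ (Fin.succ_injective n), coeff_weightedHomogeneousComponent, weight_mapDomain_succ]
  · push Not at hd
    rw [coeff_weightedHomogeneousComponent, coeff_rename_eq_zero _ _ _ (fun u hu => absurd hu (hd u)),
      coeff_rename_eq_zero _ _ _ (fun u hu => absurd hu (hd u))]
    exact ite_self 0

/-- `aeval` through a renaming by `Fin.succ` only sees the values at the successors. [folklore] -/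
theorem aeval_rename_succ {R S : Type} [CommSemiring R] [CommSemiring S] [Algebra R S] {n : ℕ} (b : Fin (n + 1) → S)
    (f : MvPolynomial (Fin n) R) : aeval b (rename Fin.succ f) = aeval (b ∘ Fin.succ) f :=
  aeval_rename _ _ _

/-! ## §4 Primality, `x̄ᵥ ≠ 0`, `Xᵢ ∤ g` across the extra variable -/

/-- Under `k[X_{n+1}] ≃ k[X_n][T]` (`finSuccEquiv`, `X 0 ↦ T`), `rename succ f ↦ C f`. [folklore] -/
theorem finSuccEquiv_rename_succ {R : Type} [CommSemiring R] {n : ℕ} (f : MvPolynomial (Fin n) R) :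
    finSuccEquiv R n (rename Fin.succ f) = Polynomial.C f := by
  have h : ((finSuccEquiv R n).toAlgHom.comp (rename Fin.succ) : MvPolynomial (Fin n) R →ₐ[R] Polynomial (MvPolynomial (Fin n) R)) =
      (Polynomial.CAlgHom : MvPolynomial (Fin n) R →ₐ[R] Polynomial (MvPolynomial (Fin n) R)) := by
    refine MvPolynomial.algHom_ext fun i => ?_
    simp [finSuccEquiv_X_succ]
  exact congrArg (fun φ : MvPolynomial (Fin n) R →ₐ[R] Polynomial (MvPolynomial (Fin n) R) => φ f) h

/-- **`(rename succ f)` is prime if `(f)` is** (`k` a field; `f = 0` allowed): `rename succ f = finSuccEquiv⁻¹ (C f)` and `Prime (C f)`.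
[folklore] -/
theorem isPrime_span_rename_succ {k : Type} [Field k] {n : ℕ} (f : MvPolynomial (Fin n) k) (hf : (Ideal.span {f}).IsPrime) :
    (Ideal.span {rename Fin.succ f} : Ideal (MvPolynomial (Fin (n + 1)) k)).IsPrime := by
  by_cases hf0 : f = 0
  · subst hf0
    rw [map_zero, Ideal.span_singleton_zero]
    exact Ideal.isPrime_bot
  · have hprime : Prime f := (Ideal.span_singleton_prime hf0).mp hf
    have hC : Prime (Polynomial.C f) := Polynomial.prime_C_iff.mpr hprime
    have hre : Prime (rename Fin.succ f : MvPolynomial (Fin (n + 1)) k) := by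
      have h2 : (finSuccEquiv k n).symm (Polynomial.C f) = rename Fin.succ f := by
        rw [← finSuccEquiv_rename_succ, AlgEquiv.symm_apply_apply]
      rw [← h2]
      exact (MulEquiv.prime_iff (finSuccEquiv k n).symm.toMulEquiv).mpr hC
    have hne : (rename Fin.succ f : MvPolynomial (Fin (n + 1)) k) ≠ 0 :=
      fun h => hf0 (rename_injective _ (Fin.succ_injective n) (by rw [h, map_zero]))
    exact (Ideal.span_singleton_prime hne).mpr hre

/-- The substitution `X 0 ↦ c`, `X (succ i) ↦ X i` retracts `rename succ`. [folklore] -/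
theorem aeval_cases_rename_succ {R : Type} [CommSemiring R] {n : ℕ} (c : MvPolynomial (Fin n) R) (g : MvPolynomial (Fin n) R) :
    aeval (Fin.cases c (fun i : Fin n => (X i : MvPolynomial (Fin n) R))) (rename Fin.succ g) = g := by
  rw [aeval_rename]
  have h : (Fin.cases c (fun i : Fin n => (X i : MvPolynomial (Fin n) R)) : Fin (n + 1) → MvPolynomial (Fin n) R) ∘ Fin.succ =
      fun i => X i := by
    funext i
    simp
  rw [h, aeval_X_left, AlgHom.coe_id, id_eq]

/-- **No variable divides `rename succ g` if none divides `g`** (`X (succ i) ∣ rename g ⇒ X i ∣ g` by `X 0 ↦ 1`; `X 0 ∣ rename g ⇒ g = 0`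
by `X 0 ↦ 0`, but `X 0 ∤ g` forces `g ≠ 0`). Requires `0 < n` (so that `g ≠ 0` is witnessed by `¬ X 0 ∣ g`). [folklore] -/
theorem X_not_dvd_rename_succ {R : Type} [CommSemiring R] {n : ℕ} (hn : 0 < n) (g : MvPolynomial (Fin n) R)
    (hg : ∀ i : Fin n, ¬ (X i ∣ g)) (i : Fin (n + 1)) : ¬ (X i ∣ rename Fin.succ g) := by
  refine Fin.cases ?_ (fun i => ?_) i
  · rintro ⟨q, hq⟩
    have h := congrArg (aeval (Fin.cases (0 : MvPolynomial (Fin n) R) (fun i : Fin n => (X i : MvPolynomial (Fin n) R)))) hq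
    rw [aeval_cases_rename_succ, map_mul, aeval_X, Fin.cases_zero, zero_mul] at h
    exact hg ⟨0, hn⟩ (h ▸ dvd_zero _)
  · rintro ⟨q, hq⟩
    have h := congrArg (aeval (Fin.cases (1 : MvPolynomial (Fin n) R) (fun i : Fin n => (X i : MvPolynomial (Fin n) R)))) hq
    rw [aeval_cases_rename_succ, map_mul, aeval_X, Fin.cases_succ] at h
    exact hg i ⟨_, h⟩

/-- **`x̄ᵥ ≠ 0` in `k[X_{n+1}]/(rename succ f)`** from `x̄ⱼ ≠ 0` in `k[X_n]/(f)` and `(f)` prime (so `f` is not a unit): `X (succ j)`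
is handled by `X 0 ↦ 0`, and `X 0 ∈ (rename f)` would make `f` divide `1` by `X 0 ↦ 1`. [folklore] -/
theorem mk_X_rename_succ_ne_zero {k : Type} [Field k] {n : ℕ} (f : MvPolynomial (Fin n) k) (hf : (Ideal.span {f}).IsPrime)
    (hXne : ∀ v : Fin n, Ideal.Quotient.mk (Ideal.span {f}) (X v) ≠ 0) (v : Fin (n + 1)) :
    Ideal.Quotient.mk (Ideal.span {rename Fin.succ f}) (X v : MvPolynomial (Fin (n + 1)) k) ≠ 0 := by
  intro h
  rw [Ideal.Quotient.eq_zero_iff_mem, Ideal.mem_span_singleton] at h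
  obtain ⟨q, hq⟩ := h
  revert hq
  refine Fin.cases ?_ (fun j => ?_) v <;> intro hq
  · -- `X 0 = rename f * q`: substitute `X 0 ↦ 1`
    have h := congrArg (aeval (Fin.cases (1 : MvPolynomial (Fin n) k) (fun i : Fin n => (X i : MvPolynomial (Fin n) k)))) hq
    rw [aeval_X, Fin.cases_zero, map_mul, aeval_cases_rename_succ] at h
    apply hf.ne_top
    rw [Ideal.eq_top_iff_one, Ideal.mem_span_singleton]
    exact ⟨_, h⟩
  · -- `X (succ j) = rename f * q`: substitute `X 0 ↦ 0`
    have h := congrArg (aeval (Fin.cases (0 : MvPolynomial (Fin n) k) (fun i : Fin n => (X i : MvPolynomial (Fin n) k)))) hq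
    rw [aeval_X, Fin.cases_succ, map_mul, aeval_cases_rename_succ] at h
    apply hXne j
    rw [Ideal.Quotient.eq_zero_iff_mem, Ideal.mem_span_singleton]
    exact ⟨_, h⟩

/-! ## §5 Fedder non-membership across the extra variable -/

/-- **`F^(p-1) ∉ ((Xᵢ − bᵢ)^p : i < n)` in `K[X_n]` implies `(rename succ F)^(p-1) ∉ ((Xᵢ − b′ᵢ)^p : i ≤ n)` in `K[X_{n+1}]`**
whenever `b′ ∘ succ = b`: specialise `X 0 ↦ b′ 0`, which kills `(X 0 − b′ 0)^p` and retracts `rename succ`. [folklore] -/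
theorem pow_not_mem_span_of_rename_succ {K : Type} [Field K] {n : ℕ} (p : ℕ) (hp : 0 < p) (F : MvPolynomial (Fin n) K)
    (b' : Fin (n + 1) → K)
    (hF : F ^ (p - 1) ∉ Ideal.span (Set.range fun i : Fin n => (X i - C (b' i.succ)) ^ p)) :
    (rename Fin.succ F) ^ (p - 1) ∉ Ideal.span (Set.range fun i : Fin (n + 1) => (X i - C (b' i)) ^ p) := by
  intro h
  apply hF
  -- `ψ : X 0 ↦ b′ 0`, `X (succ i) ↦ X i` retracts `rename succ` and kills `(X 0 − b′ 0)^p`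
  have hψF : aeval (Fin.cases (C (b' 0)) (fun i : Fin n => (X i : MvPolynomial (Fin n) K))) (rename Fin.succ F) = F :=
    aeval_cases_rename_succ _ _
  have hmem := Ideal.mem_map_of_mem
    (aeval (Fin.cases (C (b' 0)) (fun i : Fin n => (X i : MvPolynomial (Fin n) K))) :
      MvPolynomial (Fin (n + 1)) K →ₐ[K] MvPolynomial (Fin n) K).toRingHom h
  rw [map_pow, AlgHom.toRingHom_eq_coe, AlgHom.coe_toRingHom, hψF, Ideal.map_span] at hmem
  refine (Ideal.span_le.mpr ?_) hmem
  rintro _ ⟨_, ⟨i, rfl⟩, rfl⟩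
  rw [SetLike.mem_coe, AlgHom.coe_toRingHom, map_pow, map_sub, aeval_X, aeval_C, algebraMap_eq]
  refine Fin.cases ?_ (fun i => ?_) i
  · rw [Fin.cases_zero, sub_self, zero_pow hp.ne']
    exact Ideal.zero_mem _
  · rw [Fin.cases_succ]
    exact Ideal.subset_span ⟨i, rfl⟩

end Summit.ResolutionOfSingularities.ResolutionOfSingularities.Theorems.FInjectiveMacaulayfication.CNCylinder

end
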